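import Summits.AtomisticToContinuum.HydrodynamicLimit.Theorems.JParityClosureRateFloorLineDefs
import Summits.AtomisticToContinuum.HydrodynamicLimit.Theorems.JParityClosureRateFloorMarkedTransfer
import Summits.AtomisticToContinuum.HydrodynamicLimit.Theorems.JParityClosureRateFloorRealisedDatum
import Literature.MathematicalPhysics.KineticTheory.HardSphereEuler
import Summits.AtomisticToContinuum.HydrodynamicLimit.Theorems.OneFlightGossipEngineEnergyCurrentTailsFirstPartnerObjects
import HarnessLib

/-!
# The first-partner pathwise transfer P (stub `stub_firstPartnerPathwise`, line `quartic-schur-ledger`,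
# crux `EnergyCurrentTails`, stmt-AtomisticToContinuum-9235; seat c6 reshape B)

Helper file (`--supports stmt-AtomisticToContinuum-9235`) discharging the registered stub P
`stub_firstPartnerPathwise : FirstPartnerPathwise` of the lead's skeleton for the crux `EnergyCurrentTails`, line
`quartic-schur-ledger` (seat c6, reshape B of the lagged quartic mixing floor QMF₄ᴸ into `T → I → P → W`), stated
exactly as registered: the Prop `EnergyCurrentTailsFirstPartner.FirstPartnerPathwise` of the objects file
`OneFlightGossipEngineEnergyCurrentTailsFirstPartnerObjects.lean`.

**Statement.**  For `0 < σ < 1/2`, `N + 1` hard spheres of diameter `ε = hsDiameter σ N` on `𝕋³`, a hard-sphere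
flow `Φ`, a good initial datum `z`, thresholds `K₀, K₁`, a time `r` and a look-ahead `Δ > 0`:

  `ofReal (realisedFirstSum ε Δ (Φ · z) r (mixMark N K₀ K₁)) ≤ mixingFlux Φ K₀ (r, r + Δ] z`,

i.e. the quartic mixing marks `𝟙{K₀ < ‖v‖, ‖w‖ ≤ K₁} (N+1)⁻¹ 2‖v′‖²‖w′‖²` of the REALISED FIRST would-be pairs
predicted from the time-`r` configuration (read at the predicted datum: free-flight contact positions, time-`r`
velocities) are bounded by the `ℝ≥0∞`-valued mixing flux of the orbit over the window (marks
`𝟙{K₀ < ‖vᵢ⁻‖} (N+1)⁻¹ 2‖vᵢ⁺‖²‖vⱼ⁺‖²` of the ordered contact pairs at the collision times of `(r, r + Δ]`).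
DETERMINISTIC (one orbit on the good set, no probability).

**Proof.**  (1) The realised first pairs are realised pairs (`firstPairs ∩ realisedPairs ⊆ realisedPairs`) and
the mark is `≥ 0`, so `realisedFirstSum ≤` the realised marked sum of the window
(`Finset.sum_le_sum_of_subset_of_nonneg`).  (2) The marked realised transfer of the line `Sketch` of the crux
`JParityClosure.RateFloor` (`RateFloorMarkedTransfer.stub_markedTransfer`, fed with its landed antecedent
`RateFloorRealisedDatum.stub_realisedDatum`; window `(r, r + Δ]`, `t₁ = firstContact`, `R = realisedPairs` after
`r + Δ − r = Δ`) bounds the realised marked sum by the REAL collision functional of the window: the `finsum` over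
the collision times `u ∈ (r, r + Δ]` of `Σᵢ Σⱼ 𝟙[i ≠ j, ‖xᵢ(u) − xⱼ(u)‖ = ε] F u xᵢ(u) xⱼ(u) pv.1 pv.2`, `pv` the
current velocities reflected across the separation vector.  (3) Termwise in `ℝ≥0∞`: the collision times of the
window are finitely many on the good set (`HardSphereFlow.finite_collisionTimes_inter`), so both `finsum`s are
finite sums (`finsum_mem_eq_finite_toFinset_sum`) and `ofReal` is subadditive (`ofReal_sum_le_sum`); at a
collision time `u` and an ordered contact pair `(i, j)` the orbit lies in `contactSet i j` (it stays in the
hard-sphere domain, `IsHardSphereTrajectory.mem`, `mem_contactSet`), the incoming velocity of `i` recovered by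
`collidePair` IS `pv.1` (`collidePair_apply_left`), and inside the mark `reflectVel n pv = (vᵢ(u), vⱼ(u))`
(`reflectVel_reflectVel`), so the mixing mark at the transferred datum is the summand of `mixingFlux` with the
extra partner cut `‖pv.2‖ ≤ K₁`, which only decreases it (`ofReal_ite_le`); off contact / on the diagonal the
left summand is `ofReal 0 = 0`.

Constants: none (a sure inequality; `σ < 1/2` only feeds `ε < 1/2`, the range of the marked transfer).

References: Gallagher–Saint-Raymond–Texier 2013 §4.1 (hard-sphere trajectories, collision cylinders);
Cercignani–Illner–Pulvirenti 1994 §4.2 (elastic reflection, Povzner-type marks); elementary.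
-/

noncomputable section

open MeasureTheory Set Filter
open scoped ENNReal InnerProductSpace BigOperators Classical

namespace Summit.AtomisticToContinuum.HydrodynamicLimit.Theorems.QuarticSchurLedger

open Literature.MathematicalPhysics.KineticTheory Literature.Analysis.FluidPDE
open Summit.AtomisticToContinuum.HydrodynamicLimit.Theorems.RateFloorLine
open Summit.AtomisticToContinuum.HydrodynamicLimit.Theorems.EnergyCurrentTailsFirstPartner

/-! ## Two elementary `ℝ≥0∞` inequalities -/

/-- `ofReal` of a finite real sum is at most the sum of termwise `ℝ≥0∞` majorants of the `ofReal`s of its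
terms (subadditivity of `ENNReal.ofReal`; no sign condition). [folklore] -/
theorem ofReal_sum_le_sum {ι : Type*} (s : Finset ι) {f : ι → ℝ} {g : ι → ℝ≥0∞}
    (h : ∀ i ∈ s, ENNReal.ofReal (f i) ≤ g i) :
    ENNReal.ofReal (∑ i ∈ s, f i) ≤ ∑ i ∈ s, g i := by
  classical
  induction s using Finset.induction_on with
  | empty => simp
  | insert a s ha ih =>
    rw [Finset.sum_insert ha, Finset.sum_insert ha]
    exact ENNReal.ofReal_add_le.trans (add_le_add (h a (Finset.mem_insert_self a s))
      (ih fun i hi => h i (Finset.mem_insert_of_mem hi)))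

/-- A cut can only be relaxed: `ofReal (𝟙_P · x) ≤ 𝟙_Q · ofReal x` whenever `P → Q`. [folklore] -/
theorem ofReal_ite_le {P Q : Prop} [Decidable P] [Decidable Q] (hPQ : P → Q) (x : ℝ) :
    ENNReal.ofReal (if P then x else 0) ≤ if Q then ENNReal.ofReal x else 0 := by
  by_cases hP : P
  · rw [if_pos hP, if_pos (hPQ hP)]
  · rw [if_neg hP, ENNReal.ofReal_zero]
    exact zero_le

/-! ## The stub -/

/-- **P · FIRST-PARTNER PATHWISE TRANSFER** (registered stub `stub_firstPartnerPathwise` of the line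
`quartic-schur-ledger`, crux `EnergyCurrentTails`, stmt-AtomisticToContinuum-9235; seat c6 reshape B).
For `0 < σ < 1/2`, every hard-sphere flow on `𝕋³`, every good initial datum, thresholds `K₀, K₁`, time `r`
and look-ahead `Δ > 0`: `ofReal (realisedFirstSum ε Δ (Φ · z) r (mixMark N K₀ K₁)) ≤ mixingFlux Φ K₀ (r, r + Δ] z`.
Proof: (1) the realised FIRST pairs are realised pairs and the mark is `≥ 0`
(`Finset.sum_le_sum_of_subset_of_nonneg`); (2) the marked realised transfer of the line `Sketch` of
`JParityClosure.RateFloor` (`RateFloorMarkedTransfer.stub_markedTransfer` fed with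
`RateFloorRealisedDatum.stub_realisedDatum`) bounds the realised marked sum by the real collision functional
of the window with the same mark read at (contact positions, reflected current velocities); (3) termwise in
`ℝ≥0∞` over the finitely many collision times (`HardSphereFlow.finite_collisionTimes_inter`): at a contact
of `(i, j)` the orbit is in `contactSet i j` (`mem_contactSet`), the reflected current velocities are the
`collidePair` velocities (`collidePair_apply_left`), reflecting twice is the identity (`reflectVel_reflectVel`),
so the mixing mark is the summand of `mixingFlux` up to the partner cut `‖w‖ ≤ K₁`, which only decreases it
(`ofReal_ite_le`). [folklore] -/
theorem stub_firstPartnerPathwise : FirstPartnerPathwise := by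
  intro σ hσ hσ2 N Φ z hz K₀ K₁ r Δ hΔ
  have hε : 0 < hsDiameter σ N := hsDiameter_pos hσ N
  have hε2 : hsDiameter σ N < 2⁻¹ := (hsDiameter_le hσ.le N).trans_lt (hσ2.trans_eq (one_div 2))
  have htraj : IsHardSphereTrajectory (Torus.geometry (Fin 3)) (hsDiameter σ N) (N + 1)
      (fun t => Φ.flow t z) := Φ.isTrajectory z hz
  -- the mark is nonnegative
  have hF0 : ∀ u x y v w, 0 ≤ mixMark N K₀ K₁ u x y v w := by
    intro u x y v w
    dsimp only [mixMark]
    split_ifs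
    · positivity
    · exact le_rfl
  -- (1) realised first pairs are realised pairs
  have h1 : realisedFirstSum (hsDiameter σ N) Δ (fun u => Φ.flow u z) r (mixMark N K₀ K₁) ≤
      pairSum (hsDiameter σ N) Δ (Φ.flow r z) r (mixMark N K₀ K₁)
        (realisedPairs (hsDiameter σ N) Δ (fun u => Φ.flow u z) r) := by
    unfold realisedFirstSum pairSum
    exact Finset.sum_le_sum_of_subset_of_nonneg Finset.inter_subset_right fun p _ _ => hF0 _ _ _ _ _
  -- (2) the marked realised transfer of the line `Sketch` (crux `JParityClosure.RateFloor`)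
  have h2 := RateFloorMarkedTransfer.stub_markedTransfer RateFloorRealisedDatum.stub_realisedDatum (N + 1)
    (hsDiameter σ N) (fun t => Φ.flow t z) htraj hε hε2 r (r + Δ) (by linarith) (mixMark N K₀ K₁) hF0
    (fun p => firstContact (hsDiameter σ N) Δ (Φ.flow r z) p)
    (fun p => by simp only [firstContact, add_sub_cancel_left])
    (realisedPairs (hsDiameter σ N) Δ (fun t => Φ.flow t z) r)
    (by simp only [realisedPairs, add_sub_cancel_left])
  have h2' : pairSum (hsDiameter σ N) Δ (Φ.flow r z) r (mixMark N K₀ K₁)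
      (realisedPairs (hsDiameter σ N) Δ (fun u => Φ.flow u z) r) ≤ _ := h2
  -- (3) termwise comparison in `ℝ≥0∞` over the finitely many collision times of the window
  have hfin : (collisionTimes (Torus.geometry (Fin 3)) (hsDiameter σ N) (fun t => Φ.flow t z) ∩
      Set.Ioc r (r + Δ)).Finite :=
    Φ.finite_collisionTimes_inter hz Set.Ioc_subset_Icc_self
  refine (ENNReal.ofReal_le_ofReal (h1.trans h2')).trans ?_
  unfold mixingFlux
  rw [finsum_mem_eq_finite_toFinset_sum _ hfin, finsum_mem_eq_finite_toFinset_sum _ hfin]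
  refine ofReal_sum_le_sum _ fun u _ => ofReal_sum_le_sum _ fun i _ => ofReal_sum_le_sum _ fun j _ => ?_
  by_cases hij : i = j
  · rw [if_neg (fun h => h.1 hij), if_pos hij]
    exact ENNReal.ofReal_zero.le
  rw [if_neg hij]
  by_cases hc : ‖(Torus.geometry (Fin 3)).sepVec (Φ.flow u z i).1 (Φ.flow u z j).1‖ = hsDiameter σ N
  · have hmem : Φ.flow u z ∈ contactSet (Torus.geometry (Fin 3)) (N + 1) (hsDiameter σ N) i j :=
      mem_contactSet.2 ⟨htraj.mem u, hc⟩
    rw [if_pos ⟨hij, hc⟩, Set.indicator_of_mem hmem, collidePair_apply_left hij]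
    simp only [mixMark, Prod.mk.eta, reflectVel_reflectVel]
    exact ofReal_ite_le (fun h => h.1) _
  · rw [if_neg (fun h => hc h.2)]
    exact ENNReal.ofReal_zero.trans_le zero_le

end Summit.AtomisticToContinuum.HydrodynamicLimit.Theorems.QuarticSchurLedger

end
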